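import Summits.QuantumFields.BalabanUV.Beta.MultiscaleCoercive

/-!
# Beta / MultiscaleCoerciveTorus — THE INSTANCE ON pv21's TORUS `UT N` WITH CUBE CELLS (U = 1): for ANY family of pairwise
# disjoint cubes of sides `S_l ∣ N_i` (one side per level, any levels, any number of cubes) the multi-region averaged operator
# `Δ + Σ_l a_l·G_lᵀG_l` of [B9] (3.24) SHAPE with plain block means (cube-corner labels, level weights `ω_l`) satisfies
# `min(c²/(4d), a/2)·Σ_cells S_l⁻²·‖f‖²_cell ≤ ⟨f, (Δ + Σ_l a_lG_lᵀG_l) f⟩` — NO displayed binder, constant depending on d, c, a ONLY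
# (unit `b2b-balaban-beta-d4-p2`, GEN 7, MODEL crew; claim «MULTISCALE-POINCARE-MODEL» journal l.16779, node (m12) of O.2
# skeleton §8.3; over (C) `MultiscaleCoercive` p226432)

HONEST FRAMING: discharging `BetaPertH` makes Bałaban's UV stability UNCONDITIONAL — NOT the continuum limit, NOT the
Clay problem.  HONEST DEPENDENCY (verbatim): «continuum YM on T⁴ ⇐ BetaPertH ∧ nine spine estimates (0/9 proved);
BetaPertH ⇐ (D1) ∧ (D4) ∧ CAP+tail; G-an2-4 gates asym, D1 and NE2/3/4.»  THIS MODULE DISCHARGES NOTHING of `BetaPertH`,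
asserts NOTHING printed and cites nothing as a fact (ABSOLUTE RULE): [folklore] about the pv21∕b05 torus MODEL (`B5TorusCover.UT`,
cube cover `Ctr`∕`ctrU`∕`blockMap`, `B9Thm37GlueTorusCov.tblk`, bonds `(x, μ)` of `B9Thm37GluePU` with `btgt = up`) at `U = 1`
(bond matrices and transports `= 1`).  WHAT IT IS: the non-vacuity ∕ usability witness of part (C) — a CONCRETE multi-region
operator on a CONCRETE lattice with the k-uniform local lower bound and no hypothesis beyond the data (disjoint cubes); the shape
the NE2 lineage's `DirichletScalarTowerBox` header lists as «the multi-region {Ω_j, a_j} bookkeeping of (3.24)» (lower-bound half,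
U = 1).  NOT: Dirichlet holes Ω₀, print's region geometry ([B6] (2.1)–(2.2)), the decay half, `U ≠ 1` (part (B)'s `h` enters
via part (C) verbatim once tree transports on torus cubes are supplied — successor).  SHAPES located at [B9] =
`Balaban1985BackgroundPropagators` (3.24) p. 394, Thm 3.1 p. 397.  No class change on row D4 (critical-path width 0; D4
DISCHARGE NO DATE); NOT BetaPertH, NOT continuum, NOT Clay, NOT summit progress.

CONTENT (kernel, 0 sorry).  §1 the cube chart `cubePt z v` (coordinates `v_i + S·z_i`, b05 `blockMap`): injective, `tblk ∘ cubePt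
= z`, onto the block (`cubePt_tblk_offV`), corner `cubePt z 0 = ctrU z`, successor `up (cubePt z v) i = cubePt z (v + e_i)` inside the
cube.  §2 flat transports: `hol = 1`.  §3 disjoint cube families: the monotone-sum hypotheses `hbond`∕`hcell` of part (C)
DISCHARGED (`sum_cells_le`, `hbond_torus`, `hcell_torus`).  §4 END **`multiscale_coercive_torus_flat`**.
-/

namespace Summit.QuantumFields.BalabanUV.Beta.MultiscaleCoerciveTorus

open Finset Function
open Summit.QuantumFields.BalabanUV.Beta.BoxPoincare
open Summit.QuantumFields.BalabanUV.Beta.CovariantBoxPoincare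
open Summit.QuantumFields.BalabanUV.Beta.MultiscaleCoercive
open Literature.MathematicalPhysics.QuantumFieldTheory.Balaban1983to89
open Literature.MathematicalPhysics.QuantumFieldTheory.Balaban1983to89.B9Thm37Glue (covD covD_apply)
open Literature.MathematicalPhysics.QuantumFieldTheory.Balaban1983to89.B9Thm37GluePU (bsrc btgt bsrc_apply btgt_apply)
open Literature.MathematicalPhysics.QuantumFieldTheory.Balaban1983to89.B9Thm37GlueTorusCov (tblk tblk_val)
open Literature.MathematicalPhysics.QuantumFieldTheory.Balaban1983to89.B9Thm37GlueTorusCovLevels (levelOp)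
open Literature.MathematicalPhysics.QuantumFieldTheory.Balaban1983to89.B5Leibniz121 (up)
open B5TorusCover (UT Ctr ctrU ctr nC blockMap blockMap_injective)

noncomputable section

variable {d : ℕ} {N : Fin d → ℕ} [∀ i, NeZero (N i)]

/-! ## §1 The cube chart of a torus block -/

section Chart

variable {M : ℕ}

/-- `M ∣ N_i` and `N_i ≥ 1` give at least one block per axis: `1 ≤ N_i / M`. [folklore] -/
theorem one_le_div (hM : 1 ≤ M) (hdiv : ∀ i, M ∣ N i) (i : Fin d) : 1 ≤ N i / M := by
  obtain ⟨q, hq⟩ := hdiv i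
  have hN : 1 ≤ N i := UT.one_le N i
  have hq1 : 1 ≤ q := by
    rcases Nat.eq_zero_or_pos q with h0 | h0
    · rw [h0, mul_zero] at hq; omega
    · exact h0
  rw [hq, Nat.mul_div_cancel_left q hM]
  exact hq1

/-- **The cube chart**: the point of the cube `z` with offsets `v`, coordinates `v_i + M·z_i` (b05 `blockMap`).
[cite: Balaban1984PropagatorsI, (1.6) p.18] -/
def cubePt (hM : 1 ≤ M) (hdiv : ∀ i, M ∣ N i) (z : Ctr N M) (v : Box d M) : UT N :=
  UT.ofSite N fun i => blockMap (one_le_div hM hdiv i) (z i, v i)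

/-- Coordinates of the cube chart. [folklore] -/
theorem cubePt_val (hM : 1 ≤ M) (hdiv : ∀ i, M ∣ N i) (z : Ctr N M) (v : Box d M) (i : Fin d) :
    (UT.toSite N (cubePt hM hdiv z v) i).val = (v i : ℕ) + M * (z i : ℕ) := rfl

/-- The cube chart is injective in the offsets. [folklore] -/
theorem cubePt_injective (hM : 1 ≤ M) (hdiv : ∀ i, M ∣ N i) (z : Ctr N M) : Injective (cubePt hM hdiv z) := by
  intro v w h
  funext i
  have hc := congrArg (fun x => (UT.toSite N x i).val) h
  simp only [cubePt_val] at hc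
  exact Fin.ext (by omega)

/-- The cube chart lands in the block `z`. [folklore] -/
theorem tblk_cubePt (hM : 1 ≤ M) (hdiv : ∀ i, M ∣ N i) (z : Ctr N M) (v : Box d M) :
    tblk hM hdiv (cubePt hM hdiv z v) = z := by
  funext i
  apply Fin.ext
  rw [tblk_val, cubePt_val]
  have hv := (v i).2
  rw [Nat.add_mul_div_left _ _ hM, Nat.div_eq_of_lt hv, zero_add]

/-- The offsets of a torus point inside its block. [folklore] -/
def offV (hM : 1 ≤ M) (x : UT N) : Box d M := fun i => ⟨(UT.toSite N x i).val % M, Nat.mod_lt _ hM⟩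

/-- Every point is the chart image of its block label and its offsets. [folklore] -/
theorem cubePt_tblk_offV (hM : 1 ≤ M) (hdiv : ∀ i, M ∣ N i) (x : UT N) :
    cubePt hM hdiv (tblk hM hdiv x) (offV hM x) = x := by
  show UT.ofSite N _ = x
  have : (fun i => blockMap (one_le_div hM hdiv i) (tblk hM hdiv x i, offV hM x i)) = UT.toSite N x := by
    funext i
    apply Fin.ext
    show (offV hM x i : ℕ) + M * (tblk hM hdiv x i : ℕ) = _
    rw [tblk_val]
    show (UT.toSite N x i).val % M + M * ((UT.toSite N x i).val / M) = _
    exact Nat.mod_add_div _ _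
  rw [this]
  rfl

/-- **The block is the image of the chart**: `tblk x = z ↔ ∃ v, cubePt z v = x`. [folklore] -/
theorem tblk_eq_iff (hM : 1 ≤ M) (hdiv : ∀ i, M ∣ N i) (x : UT N) (z : Ctr N M) :
    tblk hM hdiv x = z ↔ ∃ v, cubePt hM hdiv z v = x := by
  constructor
  · intro h
    exact ⟨offV hM x, by rw [← h]; exact cubePt_tblk_offV hM hdiv x⟩
  · rintro ⟨v, rfl⟩
    exact tblk_cubePt hM hdiv z v

/-- The chart at offset `0` is the cube corner `ctrU z`. [folklore] -/
theorem cubePt_zero (hM : 1 ≤ M) (hdiv : ∀ i, M ∣ N i) (z : Ctr N M) :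
    cubePt hM hdiv z (fun _ => ⟨0, hM⟩) = ctrU N M z := by
  show UT.ofSite N _ = UT.ofSite N _
  congr 1
  funext i
  apply Fin.ext
  show (0 : ℕ) + M * (z i : ℕ) = M * (z i : ℕ)
  rw [zero_add]

/-- Cube corners determine the cube: `ctrU` is injective for `M ≥ 1`. [folklore] -/
theorem ctrU_injective (hM : 1 ≤ M) : Injective (ctrU N M) := by
  intro z z' h
  funext i
  have hc := congrArg (fun x => (UT.toSite N x i).val) h
  change M * (z i : ℕ) = M * (z' i : ℕ) at hc
  exact Fin.ext (Nat.eq_of_mul_eq_mul_left hM hc)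

/-- **The in-cube successor**: for `v_i + 1 < M`, `up (cubePt z v) i = cubePt z (v + e_i)` (no wrap-around inside the
cube). [folklore] -/
theorem up_cubePt (hM : 1 ≤ M) (hdiv : ∀ i, M ∣ N i) (z : Ctr N M) (v : Box d M) (i : Fin d)
    (hv : (v i : ℕ) + 1 < M) : up (cubePt hM hdiv z v) i = cubePt hM hdiv z (succ v i hv) := by
  show UT.ofSite N _ = UT.ofSite N _
  congr 1
  funext j
  by_cases hji : j = i
  · subst hji
    rw [update_self]
    apply Fin.ext
    have hlt : (v j : ℕ) + M * (z j : ℕ) + 1 < N j := by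
      have hq : nC (N j) M = N j / M := B5TorusCover.nC_eq_div (one_le_div hM hdiv j)
      have hz : (z j : ℕ) < N j / M := by rw [← hq]; exact (z j).2
      have h1 : M * ((z j : ℕ) + 1) ≤ M * (N j / M) := Nat.mul_le_mul_left M hz
      have h2 : M * (N j / M) ≤ N j := Nat.mul_div_le (N j) M
      nlinarith
    have hN2 : 1 < N j := by omega
    rw [Fin.val_add, Fin.val_one', Nat.mod_eq_of_lt hN2]
    change ((v j : ℕ) + M * (z j : ℕ) + 1) % N j = ((succ v j hv) j : ℕ) + M * (z j : ℕ)
    rw [Nat.mod_eq_of_lt hlt]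
    simp only [succ, update_self, Fin.val_mk]
    ring
  · rw [update_of_ne hji]
    show blockMap (one_le_div hM hdiv j) (z j, v j) = blockMap (one_le_div hM hdiv j) (z j, succ v i hv j)
    rw [succ, update_of_ne hji]

end Chart

/-! ## §2 Flat transports: the tree-gauge holonomy is `1` -/

section Flat

variable {Cp : Type} [Fintype Cp] [DecidableEq Cp]

/-- The identity matrix in component currency. [folklore] -/
def oneM : Cp → Cp → ℝ := fun k l => if k = l then 1 else 0

/-- The identity matrix has orthonormal columns. [folklore] -/
theorem oneM_orth (i i' : Cp) : ∑ k, oneM k i * oneM k i' = if i = i' then (1 : ℝ) else 0 := by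
  simp only [oneM]
  rw [Finset.sum_eq_single i (fun k _ hk => by rw [if_neg hk, zero_mul]) (fun h => absurd (mem_univ i) h)]
  by_cases h : i = i' <;> simp [h]

/-- With transports and bond matrices `= 1` the thin-loop holonomy is `1`. [folklore] -/
theorem hol_flat {Bd : Type} {ν n : ℕ} (e : (v : Box ν n) → (i : Fin ν) → ((v i : ℕ) + 1 < n) → Bd)
    (v : Box ν n) (i : Fin ν) (hv : (v i : ℕ) + 1 < n) (a j : Cp) :
    hol (fun _ : Bd => (oneM : Cp → Cp → ℝ)) (fun _ : Box ν n => oneM) e v i hv a j = if a = j then 1 else 0 := by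
  simp only [hol, oneM]
  rw [Finset.sum_eq_single a (fun k _ hk => Finset.sum_eq_zero fun l _ => by rw [if_neg (Ne.symm hk)]; ring)
    (fun h => absurd (mem_univ a) h)]
  rw [Finset.sum_eq_single j (fun l _ hl => by rw [if_neg (Ne.symm hl)]; ring) (fun h => absurd (mem_univ j) h)]
  by_cases h : a = j
  · subst h; simp
  · simp [h]

/-- Hence the defect hypothesis of part (B) holds with `h = 0`. [folklore] -/
theorem defect_flat {Bd : Type} {ν n : ℕ} (e : (v : Box ν n) → (i : Fin ν) → ((v i : ℕ) + 1 < n) → Bd)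
    (v : Box ν n) (i : Fin ν) (hv : (v i : ℕ) + 1 < n) (u : Cp → ℝ) :
    ∑ a, (∑ j, (hol (fun _ : Bd => (oneM : Cp → Cp → ℝ)) (fun _ : Box ν n => oneM) e v i hv a j -
      if a = j then 1 else 0) * u j) ^ 2 ≤ (0 : ℝ) ^ 2 * ∑ j, u j ^ 2 := by
  have : ∀ a, ∑ j, (hol (fun _ : Bd => (oneM : Cp → Cp → ℝ)) (fun _ : Box ν n => oneM) e v i hv a j -
      if a = j then 1 else 0) * u j = 0 := fun a =>
    Finset.sum_eq_zero fun j _ => by rw [hol_flat, sub_self, zero_mul]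
  simp [this]

end Flat

/-! ## §3 Disjoint cube families: the monotone-sum hypotheses of part (C) discharged -/

section Family

variable {J K : Type} [Fintype J] [Fintype K] (S : J → ℕ) (hS : ∀ l, 1 ≤ S l) (hdivS : ∀ l i, S l ∣ N i)
  (lvl : K → J) (zc : (k : K) → Ctr N (S (lvl k)))

/-- The chart of cell `k`. [folklore] -/
def cellPt (k : K) (v : Box d (S (lvl k))) : UT N := cubePt (hS (lvl k)) (hdivS (lvl k)) (zc k) v

omit [Fintype J] [Fintype K] in
/-- Pairwise disjoint cells ⟹ the total chart on the disjoint union of the boxes is injective. [folklore] -/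
theorem sigma_injective (hdisj : ∀ k k' v v', cellPt S hS hdivS lvl zc k v = cellPt S hS hdivS lvl zc k' v' → k = k') :
    Injective (fun p : (Σ k, Box d (S (lvl k))) => cellPt S hS hdivS lvl zc p.1 p.2) := by
  rintro ⟨k, v⟩ ⟨k', v'⟩ h
  obtain rfl := hdisj k k' v v' h
  obtain rfl := cubePt_injective (hS (lvl k)) (hdivS (lvl k)) (zc k) h
  rfl

omit [Fintype J] in
/-- **Summing a non-negative function over disjoint cells is dominated by the sum over the torus.** [folklore] -/
theorem sum_cells_le (hdisj : ∀ k k' v v', cellPt S hS hdivS lvl zc k v = cellPt S hS hdivS lvl zc k' v' → k = k')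
    (G : UT N → ℝ) (hG : ∀ x, 0 ≤ G x) :
    ∑ k, ∑ v : Box d (S (lvl k)), G (cellPt S hS hdivS lvl zc k v) ≤ ∑ x, G x := by
  classical
  have hinj := sigma_injective S hS hdivS lvl zc hdisj
  calc ∑ k, ∑ v : Box d (S (lvl k)), G (cellPt S hS hdivS lvl zc k v)
      = ∑ p : (Σ k, Box d (S (lvl k))), G (cellPt S hS hdivS lvl zc p.1 p.2) := by
        rw [← Finset.univ_sigma_univ, Finset.sum_sigma]
    _ = ∑ x ∈ Finset.univ.image (fun p : (Σ k, Box d (S (lvl k))) => cellPt S hS hdivS lvl zc p.1 p.2), G x := by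
        rw [Finset.sum_image fun p _ q _ h => hinj h]
    _ ≤ ∑ x, G x := Finset.sum_le_univ_sum_of_nonneg hG

omit [Fintype J] in
/-- **`hbond` of part (C) on the torus**: the cells' in-cube bonds `(x, μ)` are pairwise distinct. [folklore] -/
theorem hbond_torus (hdisj : ∀ k k' v v', cellPt S hS hdivS lvl zc k v = cellPt S hS hdivS lvl zc k' v' → k = k')
    (F : UT N × Fin d → ℝ) (hF : ∀ b, 0 ≤ F b) :
    ∑ k, ∑ v : Box d (S (lvl k)), ∑ i : Fin d,
        (if _hv : (v i : ℕ) + 1 < S (lvl k) then F (cellPt S hS hdivS lvl zc k v, i) else 0) ≤ ∑ b, F b := by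
  calc ∑ k, ∑ v : Box d (S (lvl k)), ∑ i : Fin d,
        (if _hv : (v i : ℕ) + 1 < S (lvl k) then F (cellPt S hS hdivS lvl zc k v, i) else 0)
      ≤ ∑ k, ∑ v : Box d (S (lvl k)), ∑ i : Fin d, F (cellPt S hS hdivS lvl zc k v, i) :=
        Finset.sum_le_sum fun k _ => Finset.sum_le_sum fun v _ => Finset.sum_le_sum fun i _ => by
          split_ifs
          · exact le_rfl
          · exact hF _
    _ ≤ ∑ x, ∑ i : Fin d, F (x, i) :=
        sum_cells_le S hS hdivS lvl zc hdisj (fun x => ∑ i : Fin d, F (x, i)) fun x => sum_nonneg fun i _ => hF _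
    _ = ∑ b, F b := (Fintype.sum_prod_type _).symm

/-- **`hcell` of part (C) on the torus**: disjoint cells are distinct as (level, corner) pairs. [folklore] -/
theorem hcell_torus (hdisj : ∀ k k' v v', cellPt S hS hdivS lvl zc k v = cellPt S hS hdivS lvl zc k' v' → k = k')
    (a : J → ℝ) (ha : ∀ j, 0 ≤ a j) (A : J → UT N → ℝ) (hA : ∀ j β, 0 ≤ A j β) :
    ∑ k, a (lvl k) * A (lvl k) (ctrU N (S (lvl k)) (zc k)) ≤ ∑ j, a j * ∑ β, A j β := by
  classical
  let ψ : K → J × UT N := fun k => (lvl k, ctrU N (S (lvl k)) (zc k))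
  have hψ : Injective ψ := by
    intro k k' h
    have hl : lvl k = lvl k' := congrArg Prod.fst h
    have hc : ctrU N (S (lvl k)) (zc k) = ctrU N (S (lvl k')) (zc k') := congrArg Prod.snd h
    apply hdisj k k' (fun _ => ⟨0, hS (lvl k)⟩) (fun _ => ⟨0, hS (lvl k')⟩)
    simp only [cellPt]
    rw [cubePt_zero, cubePt_zero]
    exact hc
  calc ∑ k, a (lvl k) * A (lvl k) (ctrU N (S (lvl k)) (zc k)) = ∑ k, (fun q : J × UT N => a q.1 * A q.1 q.2) (ψ k) :=
        rfl
    _ = ∑ q ∈ Finset.univ.image ψ, a q.1 * A q.1 q.2 := by rw [Finset.sum_image fun k _ k' _ h => hψ h]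
    _ ≤ ∑ q : J × UT N, a q.1 * A q.1 q.2 :=
        Finset.sum_le_univ_sum_of_nonneg fun q => mul_nonneg (ha q.1) (hA q.1 q.2)
    _ = ∑ j, a j * ∑ β, A j β := by
        rw [Fintype.sum_prod_type]
        exact Finset.sum_congr rfl fun j _ => by rw [Finset.mul_sum]

end Family

/-! ## §4 The END on the torus at `U = 1` -/

section End

variable {Cp J K : Type} [Fintype Cp] [DecidableEq Cp] [Fintype J] [Fintype K]

/-- **THE MULTI-REGION AVERAGED OPERATOR ON THE TORUS IS LOCALLY, k-UNIFORMLY COERCIVE AT U = 1 (MODEL).**  Torus `UT N`,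
levels `J` with cube sides `1 ≤ S_l ∣ N_i`, the operator `levelOp bsrc btgt c 1 (l x ↦ corner of the S_l-cube of x)
(l x ↦ ω_l(corner)) 1 a = Δ + Σ_l a_l·G_lᵀG_l` (plain block sums with level weights, `a ≥ 0`, `|c| ≥ c_min > 0`), and ANY family
of pairwise disjoint cubes (cell `k` = the `S_{l_k}`-cube with index `z_k`) whose averaging weights have print's size
`a_{l_k}·ω_{l_k}(corner_k)²·S_{l_k}^d ≥ a_min/S_{l_k}²`: **`min(c_min²/(4d), a_min/2)·Σ_k S_{l_k}⁻²·Σ_{x ∈ cube k}|f(x)|² ≤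
⟨f, (Δ + Σ_l a_lG_lᵀG_l)f⟩`** — no displayed binder; the constant depends on `d`, `c_min`, `a_min` only.
[cite: Balaban1985BackgroundPropagators, (3.24) p.394 + Thm 3.1 p.397] -/
theorem multiscale_coercive_torus_flat (hd : 1 ≤ d) (S : J → ℕ) (hS : ∀ l, 1 ≤ S l) (hdivS : ∀ l i, S l ∣ N i)
    (a : J → ℝ) (ha : ∀ j, 0 ≤ a j) (ω : J → UT N → ℝ) (c : UT N × Fin d → ℝ) {cmin : ℝ} (hcmin : 0 < cmin)
    (hc : ∀ b, cmin ≤ |c b|) (lvl : K → J) (zc : (k : K) → Ctr N (S (lvl k)))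
    (hdisj : ∀ k k' v v', cellPt S hS hdivS lvl zc k v = cellPt S hS hdivS lvl zc k' v' → k = k')
    {amin : ℝ} (hamin : 0 ≤ amin)
    (hscale : ∀ k, amin / (S (lvl k) : ℝ) ^ 2 ≤
      a (lvl k) * ω (lvl k) (ctrU N (S (lvl k)) (zc k)) ^ 2 * (S (lvl k) : ℝ) ^ d)
    (f : UT N × Cp → ℝ) :
    min (cmin ^ 2 / (4 * d)) (amin / 2) *
        ∑ k, ((S (lvl k) : ℝ) ^ 2)⁻¹ * ∑ v : Box d (S (lvl k)), ∑ i, f (cellPt S hS hdivS lvl zc k v, i) ^ 2 ≤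
      ∑ p, f p * levelOp bsrc btgt c (fun _ => (oneM : Cp → Cp → ℝ))
        (fun l x => ctrU N (S l) (tblk (hS l) (hdivS l) x)) (fun l x => ω l (ctrU N (S l) (tblk (hS l) (hdivS l) x)))
        (fun _ _ => (oneM : Cp → Cp → ℝ)) a f p := by
  have h := multiscale_coercive_scaled (ν := d) bsrc btgt c (fun _ => (oneM : Cp → Cp → ℝ))
    (fun l x => ctrU N (S l) (tblk (hS l) (hdivS l) x)) (fun l x => ω l (ctrU N (S l) (tblk (hS l) (hdivS l) x)))
    (fun _ _ => (oneM : Cp → Cp → ℝ)) a (fun k => S (lvl k)) lvl (fun k => ctrU N (S (lvl k)) (zc k))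
    (fun k => ω (lvl k) (ctrU N (S (lvl k)) (zc k))) (fun _ => 0) (cellPt S hS hdivS lvl zc)
    (fun k v i _ => (cellPt S hS hdivS lvl zc k v, i))
    (fun _ _ i i' => oneM_orth i i') hcmin
    (fun k => cubePt_injective (hS (lvl k)) (hdivS (lvl k)) (zc k))
    (fun k x => by
      show _ ↔ ∃ v, cubePt (hS (lvl k)) (hdivS (lvl k)) (zc k) v = x
      rw [← tblk_eq_iff (hS (lvl k)) (hdivS (lvl k)) x (zc k)]
      exact ⟨fun h => ctrU_injective (hS (lvl k)) h, fun h => by rw [h]⟩)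
    (fun k v => by simp only [cellPt, tblk_cubePt])
    (fun k v i hv => rfl)
    (fun k v i hv => by
      simp only [cellPt, btgt_apply]
      exact up_cubePt (hS (lvl k)) (hdivS (lvl k)) (zc k) v i hv)
    (fun k v i hv => hc _)
    (fun k v i hv u => defect_flat _ v i hv u)
    (hbond_torus S hS hdivS lvl zc hdisj) (hcell_torus S hS hdivS lvl zc hdisj a ha)
    hd (fun k => hS (lvl k)) hamin hscale (θ := 0) (fun k => by simp) f
  simpa using h

end End

end

end Summit.QuantumFields.BalabanUV.Beta.MultiscaleCoerciveTorus
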